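import Literature.NumberTheory.EllipticCurves.PAdicLFunctionIntegralityAtTwoAutoProofs
import HarnessLib

/-!
# The Hecke relation at `2` run TWICE: `2[1/4]⁺ = (a₂² − 2a₂ − 1)[0]⁺` and `(a₂ − 3)(a₂ + 1)·[0]⁺_f ∈ ℤ` for every
# newform of odd level with real coefficients — so `L(f,1)/Ω⁺_f ∈ ⅓ℤ` is `2`-INTEGRAL when `a₂ ∈ {0, ±2}` (proofs only)

A *proofs* file (theorems only: no definition, no named fact). It sharpens §1–§2 of
`PAdicLFunctionIntegralityAtTwoAutoProofs` (`(a₂ − 3)[0]⁺ ∈ ½ℤ`, ONE application of `T₂` at the cusp `0` plus Manin's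
trick at `1/2`) by a factor `2`, applying `T₂` a SECOND time, at the cusp `1/2`:
`a₂[1/2]⁺ = [1/4]⁺ + [3/4]⁺ + [1]⁺ = 2[1/4]⁺ + [0]⁺` (`[3/4]⁺ = [−1/4]⁺ = [1/4]⁺`, `[1]⁺ = [0]⁺`), whence with
`[1/2]⁺ = (a₂ − 2)[0]⁺`:
* `two_mul_normalizedPlusSymbol_quarter_eq` — **`2[1/4]⁺ = (a₂² − 2a₂ − 1)·[0]⁺`**;
* `exists_mul_normalizedPlusSymbol_zero_eq_intCast` — Manin at the cusp `1/4` (`[1/4]⁺ − [0]⁺ ∈ ½ℤ`) then gives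
  **`(a₂ − 3)(a₂ + 1)·[0]⁺ ∈ ℤ`** (not merely `½ℤ`); rational versions `two_mul_ratPlusSymbol_quarter_eq`,
  `exists_mul_ratPlusSymbol_zero_eq_intCast`;
* for `a₂` EVEN — i.e. `f` supersingular at `2`, `a₂ ∈ {0, ±2}` by the Hasse bound — the factor `(a₂ − 3)(a₂ + 1)` is ODD, so
  **`‖[0]⁺_f‖₂ ≤ 1`: `L(f,1)/Ω⁺_f` is `2`-integral** (`norm_ratPlusSymbol_zero_le_one_of_even`), with
  `‖[0]⁺‖₂ = ‖k‖₂` for the integer `k = (a₂ − 3)(a₂ + 1)[0]⁺` (`norm_ratPlusSymbol_zero_eq_of_even`); at `a₂ = 0`: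
  `3·[0]⁺ ∈ ℤ`, `[1/4]⁺ = −[0]⁺/2` (`exists_three_mul_ratPlusSymbol_zero_eq_neg_intCast`, `ratPlusSymbol_quarter_eq_of_cuspCoeff_two_eq_zero`).
  Checks in print: `19a1`, `27a1` (`a₂ = 0`): `L/Ω = 1/3`; `11a1` (`a₂ = −2`): `(−5)(−1)·(1/5) = 1`.
For ODD `a₂` (ordinary at `2`) the factor is divisible by `4` and nothing beyond the parent file follows.
USE (cell `bsd-wall`, crux Kμ⁺ stmt-BirchSwinnertonDyer-20689, lead rtt-p4 g4's memo `FlatCuspSpan.md` §2 (2), «the parity identity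
alone is a cheap kernel lemma»): the layer-`0` Mazur–Tate coefficient at `2` of an `a₂ = 0` newform is `2[1/4]⁺ = −[0]⁺ = −L(f,1)/Ω⁺_f`, a
`2`-adic integer, a unit iff `3L(f,1)/Ω⁺_f` is odd — the layer-`0` certificate of `μ(L♭_f) = 0`. Nothing about BSD is proved here.

STATUS IN PRINT: elementary (two Hecke relations and Manin's trick); Mazur–Tate–Teitelbaum 1986 §I.4 (4.2), §I.8; Cremona 1997 §2.8;
the `a₂ = 0` reading `L(f,1)/Ω⁺ ∈ ⅓ℤ₍₂₎` is the `p = 2` case of the «`#Ẽ(𝔽_p)·L(E,1)/Ω ∈ ℤ_(p)`» folklore (here `#Ẽ(𝔽₂) = 3 − a₂`).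

## References
* B. Mazur, J. Tate, J. Teitelbaum, Invent. Math. 84 (1986), §I.4 (4.2), §I.8. [MazurTateTeitelbaum1986Invent]
* J. E. Cremona, *Algorithms for modular elliptic curves*, 2nd ed. (1997), §2.8. [CremonaAlgorithms1997]
* Ju. I. Manin, *Parabolic points and zeta functions of modular curves* (1972), Prop. 1.4, Thm. 1.6. [Manin1972]
-/

noncomputable section

open scoped MatrixGroups

open CongruenceSubgroup Literature.NumberTheory.EllipticCurves.ModularForms

namespace Literature.NumberTheory.EllipticCurves.ModularForms

/-! ### §1. Real symbols: periodicity, evenness, the Hecke relation at `1/2` -/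

section Symbols

variable {N : ℕ} [NeZero N] (f : CuspForm (Gamma0 N) 2)

/-- `[r + n]⁺_f = [r]⁺_f` for `n ∈ ℤ` (`{∞, r + n} = {∞, r}`, `modularSymbol_add_intCast_holds`). [cite: Manin1972, §1.2] -/
theorem normalizedPlusSymbol_add_intCast (r : ℚ) (n : ℤ) :
    normalizedPlusSymbol f (r + n) = normalizedPlusSymbol f r := by
  have h1 : modularSymbol f (r + n) = modularSymbol f r := by
    exact_mod_cast modularSymbol_add_intCast_holds f r n
  have h2 : modularSymbol f (-(r + n)) = modularSymbol f (-r) := by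
    have h := modularSymbol_add_intCast_holds f (-r) (-n)
    push_cast at h
    rw [← h]
    ring_nf
  simp only [normalizedPlusSymbol, plusSymbol, h1, h2]

omit [NeZero N] in
/-- `[−r]⁺_f = [r]⁺_f` (the plus symbol is even, `plusSymbol_neg`). [cite: MazurTateTeitelbaum1986Invent, §I.8] -/
theorem normalizedPlusSymbol_neg (r : ℚ) : normalizedPlusSymbol f (-r) = normalizedPlusSymbol f r := by
  simp only [normalizedPlusSymbol, plusSymbol_neg]

/-- **The Hecke relation at the cusp `1/2` for `p = 2 ∤ N`**: `a₂[1/2]⁺ = [1/4]⁺ + [3/4]⁺ + [1]⁺ = 2[1/4]⁺ + [0]⁺`.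
[cite: MazurTateTeitelbaum1986Invent, §I.4 (4.2)] -/
theorem intCast_mul_normalizedPlusSymbol_half_eq {f : CuspForm (Gamma0 N) 2} (hf : IsNewform0 f) (h2N : ¬ 2 ∣ N)
    {a₂ : ℤ} (ha₂ : cuspCoeff f 2 = a₂) :
    (a₂ : ℝ) * normalizedPlusSymbol f (1 / 2) = 2 * normalizedPlusSymbol f (1 / 4) + normalizedPlusSymbol f 0 := by
  have h := intCast_mul_normalizedPlusSymbol 2 hf Nat.prime_two h2N ha₂ (1 / 2)
  rw [Fin.sum_univ_two] at h
  simp only [Fin.val_zero, Fin.val_one, Nat.cast_zero, Nat.cast_one, add_zero, Nat.cast_ofNat] at h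
  have e1 : (1 / 2 : ℚ) / 2 = 1 / 4 := by norm_num
  have e2 : ((1 / 2 : ℚ) + 1) / 2 = -(1 / 4) + ((1 : ℤ) : ℚ) := by norm_num
  have e3 : (2 : ℚ) * (1 / 2) = (0 : ℚ) + ((1 : ℤ) : ℚ) := by norm_num
  rw [e1, e2, e3, normalizedPlusSymbol_add_intCast, normalizedPlusSymbol_add_intCast, normalizedPlusSymbol_neg] at h
  linarith

/-- **`2[1/4]⁺_f = (a₂² − 2a₂ − 1)·[0]⁺_f`** for a newform of odd level: the Hecke relation at `2` applied at `0`
(`[1/2]⁺ = (a₂ − 2)[0]⁺`, `normalizedPlusSymbol_half_eq`) and at `1/2` (previous theorem). At `a₂ = 0`: `2[1/4]⁺ = −[0]⁺`.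
[cite: MazurTateTeitelbaum1986Invent, §I.4 (4.2)] -/
theorem two_mul_normalizedPlusSymbol_quarter_eq {f : CuspForm (Gamma0 N) 2} (hf : IsNewform0 f) (h2N : ¬ 2 ∣ N)
    {a₂ : ℤ} (ha₂ : cuspCoeff f 2 = a₂) :
    2 * normalizedPlusSymbol f (1 / 4) = ((a₂ : ℝ) ^ 2 - 2 * a₂ - 1) * normalizedPlusSymbol f 0 := by
  have h1 := intCast_mul_normalizedPlusSymbol_half_eq hf h2N ha₂
  rw [normalizedPlusSymbol_half_eq hf h2N ha₂] at h1
  linarith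

/-- **`(a₂ − 3)(a₂ + 1)·[0]⁺_f ∈ ℤ`** for a newform of ODD level with real coefficients: Manin's trick at the cusp `1/4`
(denominator `4`, prime to `N`) gives `[1/4]⁺ − [0]⁺ ∈ ½ℤ`, i.e. `2[1/4]⁺ − 2[0]⁺ ∈ ℤ`, and `2[1/4]⁺ = (a₂² − 2a₂ − 1)[0]⁺`.
This SHARPENS `exists_sub_three_mul_normalizedPlusSymbol_zero_eq_div_two` (`(a₂ − 3)[0]⁺ ∈ ½ℤ`) by the factor `(a₂ + 1)/2`.
[cite: MazurTateTeitelbaum1986Invent, §I.4 (4.2) and §I.8] [cite: CremonaAlgorithms1997, §2.8] -/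
theorem exists_mul_normalizedPlusSymbol_zero_eq_intCast {f : CuspForm (Gamma0 N) 2} (hf : IsNewform0 f)
    (hreal : ∀ n, (cuspCoeff f n).im = 0) (h2N : ¬ 2 ∣ N) {a₂ : ℤ} (ha₂ : cuspCoeff f 2 = a₂) :
    ∃ k : ℤ, (((a₂ : ℝ) - 3) * (a₂ + 1)) * normalizedPlusSymbol f 0 = (k : ℝ) := by
  have hx : Nat.Coprime (1 / 4 : ℚ).den N := by
    have h := coprime_den_div_prime_pow (p := 2) h2N 1 2
    have e : ((1 : ℕ) : ℚ) / ((2 : ℕ) : ℚ) ^ 2 = 1 / 4 := by norm_num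
    rwa [e] at h
  obtain ⟨k, hk⟩ := exists_normalizedPlusSymbol_sub_zero_eq_div_two f hreal hx
  refine ⟨k, ?_⟩
  have h2 := two_mul_normalizedPlusSymbol_quarter_eq hf h2N ha₂
  have hk' : 2 * normalizedPlusSymbol f (1 / 4) - 2 * normalizedPlusSymbol f 0 = (k : ℝ) := by
    rw [← mul_sub, hk]; ring
  rw [h2] at hk'
  linarith

end Symbols

end Literature.NumberTheory.EllipticCurves.ModularForms

namespace Literature.NumberTheory.EllipticCurves

/-! ### §2. Rational symbols -/

section RatSymbols

variable {N : ℕ} [NeZero N] (f : CuspForm (Gamma0 N) 2)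

/-- **`2 · ratPlusSymbol f (1/4) = (a₂² − 2a₂ − 1) · ratPlusSymbol f 0`** (odd level; when `[0]⁺ ∉ ℚ` both sides are the junk
value `0`). [cite: MazurTateTeitelbaum1986Invent, §I.4 (4.2) and §I.8] -/
theorem two_mul_ratPlusSymbol_quarter_eq {f : CuspForm (Gamma0 N) 2} (hf : IsNewform0 f) (h2N : ¬ 2 ∣ N) {a₂ : ℤ}
    (ha₂ : cuspCoeff f 2 = a₂) :
    2 * ratPlusSymbol f (1 / 4) = ((a₂ : ℚ) ^ 2 - 2 * a₂ - 1) * ratPlusSymbol f 0 := by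
  classical
  have h := two_mul_normalizedPlusSymbol_quarter_eq hf h2N ha₂
  by_cases h0 : ∃ q : ℚ, (q : ℝ) = normalizedPlusSymbol f 0
  · have hq : ∃ q : ℚ, (q : ℝ) = normalizedPlusSymbol f (1 / 4) := by
      obtain ⟨q, hq⟩ := h0
      refine ⟨((a₂ : ℚ) ^ 2 - 2 * a₂ - 1) * q / 2, ?_⟩
      push_cast
      rw [hq]
      linarith
    unfold ratPlusSymbol
    rw [dif_pos hq, dif_pos h0]
    apply Rat.cast_injective (α := ℝ)
    push_cast
    rw [hq.choose_spec, h0.choose_spec, h]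
  · have hq : ¬ ∃ q : ℚ, (q : ℝ) = normalizedPlusSymbol f (1 / 4) := by
      rintro ⟨q, hq⟩
      -- `(a₂² − 2a₂ − 1)` is never `0` for an integer `a₂` (its discriminant `8` is not a square), so `[0]⁺` would be rational
      have hne : ((a₂ : ℝ) ^ 2 - 2 * a₂ - 1) ≠ 0 := by
        have hz : (a₂ : ℤ) ^ 2 - 2 * a₂ - 1 ≠ 0 := by
          intro hz
          have h8 : (a₂ - 1) ^ 2 = 2 := by linarith
          have habs : (a₂ - 1) ^ 2 = (|a₂ - 1|) ^ 2 := (sq_abs _).symm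
          rcases le_or_gt (|a₂ - 1|) 1 with hle | hlt
          · nlinarith [abs_nonneg (a₂ - 1)]
          · nlinarith
        exact_mod_cast hz
      refine h0 ⟨2 * q / ((a₂ : ℚ) ^ 2 - 2 * a₂ - 1), ?_⟩
      have hne' : ((a₂ : ℚ) ^ 2 - 2 * a₂ - 1) ≠ 0 := by exact_mod_cast (show ((a₂ : ℝ) ^ 2 - 2 * a₂ - 1) ≠ 0 from hne)
      push_cast
      rw [hq, h]
      exact mul_div_cancel_left₀ _ hne
    unfold ratPlusSymbol
    rw [dif_neg hq, dif_neg h0]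
    simp

/-- **`(a₂ − 3)(a₂ + 1) · ratPlusSymbol f 0 = k ∈ ℤ`** for a newform of odd level with real coefficients (`[0]⁺ ∉ ℚ`: junk
`0 = 0`). [cite: MazurTateTeitelbaum1986Invent, §I.4 (4.2) and §I.8] [cite: CremonaAlgorithms1997, §2.8] -/
theorem exists_mul_ratPlusSymbol_zero_eq_intCast {f : CuspForm (Gamma0 N) 2} (hf : IsNewform0 f)
    (hreal : ∀ n, (cuspCoeff f n).im = 0) (h2N : ¬ 2 ∣ N) {a₂ : ℤ} (ha₂ : cuspCoeff f 2 = a₂) :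
    ∃ k : ℤ, (((a₂ : ℚ) - 3) * (a₂ + 1)) * ratPlusSymbol f 0 = (k : ℚ) := by
  classical
  by_cases h0 : ∃ q : ℚ, (q : ℝ) = normalizedPlusSymbol f 0
  · obtain ⟨k, hk⟩ := exists_mul_normalizedPlusSymbol_zero_eq_intCast hf hreal h2N ha₂
    refine ⟨k, ?_⟩
    unfold ratPlusSymbol
    rw [dif_pos h0]
    apply Rat.cast_injective (α := ℝ)
    push_cast
    rw [h0.choose_spec, hk]
  · refine ⟨0, ?_⟩
    unfold ratPlusSymbol
    rw [dif_neg h0]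
    simp

/-- **`a₂ = 0`: `3 · [0]⁺_f = −k ∈ ℤ`**, i.e. `L(f,1)/Ω⁺_f ∈ ⅓ℤ` for a newform of odd level with real coefficients and `a₂ = 0`
(the `3` is `#Ẽ(𝔽₂) = 3 − a₂`; e.g. `19a1`, `27a1`: `L/Ω = 1/3`). [cite: MazurTateTeitelbaum1986Invent, §I.4 (4.2) and §I.8] -/
theorem exists_three_mul_ratPlusSymbol_zero_eq_intCast {f : CuspForm (Gamma0 N) 2} (hf : IsNewform0 f)
    (hreal : ∀ n, (cuspCoeff f n).im = 0) (h2N : ¬ 2 ∣ N) (ha₂ : cuspCoeff f 2 = 0) :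
    ∃ k : ℤ, 3 * ratPlusSymbol f 0 = (k : ℚ) := by
  obtain ⟨k, hk⟩ := exists_mul_ratPlusSymbol_zero_eq_intCast hf hreal h2N (a₂ := 0) (by rw [ha₂]; simp)
  exact ⟨-k, by push_cast at hk ⊢; linarith⟩

/-- **`a₂ = 0`: `[1/4]⁺_f = −[0]⁺_f / 2`** — the (halved) layer-`0` Mazur–Tate coefficient at `2` is minus half the `L`-value.
[cite: MazurTateTeitelbaum1986Invent, §I.4 (4.2)] -/
theorem ratPlusSymbol_quarter_eq_of_cuspCoeff_two_eq_zero {f : CuspForm (Gamma0 N) 2} (hf : IsNewform0 f) (h2N : ¬ 2 ∣ N)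
    (ha₂ : cuspCoeff f 2 = 0) :
    ratPlusSymbol f (1 / 4) = -(ratPlusSymbol f 0) / 2 := by
  have h := two_mul_ratPlusSymbol_quarter_eq hf h2N (a₂ := 0) (by rw [ha₂]; simp)
  push_cast at h
  linarith

end RatSymbols

/-! ### §3. `2`-adic norms: `L(f,1)/Ω⁺_f` is `2`-integral when `a₂` is even -/

section Norms

variable {N : ℕ} [NeZero N]

/-- `‖c‖₂ = 1` for an odd integer `c`. [folklore] -/
private theorem padicNorm_two_intCast_eq_one_of_odd {c : ℤ} (hc : Odd c) : ‖(c : ℚ_[2])‖ = 1 := by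
  rcases (Padic.norm_int_le_one (p := 2) c).lt_or_eq with hlt | heq
  · exfalso
    have h2 : (2 : ℤ) ∣ c := by exact_mod_cast (Padic.norm_intCast_lt_one_iff (p := 2)).mp hlt
    exact (Int.not_even_iff_odd.mpr hc) (even_iff_two_dvd.mpr h2)
  · exact heq

/-- For EVEN `a₂` the factor `(a₂ − 3)(a₂ + 1)` is odd. [folklore] -/
private theorem odd_sub_three_mul_add_one_of_even {a₂ : ℤ} (ha : Even a₂) : Odd ((a₂ - 3) * (a₂ + 1)) := by
  obtain ⟨t, rfl⟩ := ha
  exact ⟨2 * t * t - 2 * t - 2, by ring⟩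

/-- **`‖[0]⁺_f‖₂ = ‖k‖₂` with `k = (a₂ − 3)(a₂ + 1)[0]⁺ ∈ ℤ`, for a newform of odd level, real coefficients, `a₂` EVEN.**
[cite: MazurTateTeitelbaum1986Invent, §I.4 (4.2) and §I.8] -/
theorem norm_ratPlusSymbol_zero_eq_of_even {f : CuspForm (Gamma0 N) 2} (hf : IsNewform0 f)
    (hreal : ∀ n, (cuspCoeff f n).im = 0) (h2N : ¬ 2 ∣ N) {a₂ : ℤ} (ha₂ : cuspCoeff f 2 = a₂) (ha : Even a₂) :
    ∃ k : ℤ, (((a₂ : ℚ) - 3) * (a₂ + 1)) * ratPlusSymbol f 0 = (k : ℚ) ∧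
      ‖((ratPlusSymbol f 0 : ℚ) : ℚ_[2])‖ = ‖(k : ℚ_[2])‖ := by
  obtain ⟨k, hk⟩ := exists_mul_ratPlusSymbol_zero_eq_intCast hf hreal h2N ha₂
  refine ⟨k, hk, ?_⟩
  have hc : ‖(((a₂ - 3) * (a₂ + 1) : ℤ) : ℚ_[2])‖ = 1 :=
    padicNorm_two_intCast_eq_one_of_odd (odd_sub_three_mul_add_one_of_even ha)
  have hk2 : (((a₂ - 3) * (a₂ + 1) : ℤ) : ℚ_[2]) * ((ratPlusSymbol f 0 : ℚ) : ℚ_[2]) = (k : ℚ_[2]) := by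
    have h := congrArg (fun x : ℚ ↦ (x : ℚ_[2])) hk
    push_cast at h ⊢
    exact h
  have hn := congrArg (‖·‖) hk2
  simp only [norm_mul, hc, one_mul] at hn
  exact hn

/-- **`L(f,1)/Ω⁺_f` is `2`-INTEGRAL for a newform of odd level with real coefficients and `a₂` even** (`a₂ ∈ {0, ±2}`:
supersingular at `2`): `‖[0]⁺_f‖₂ ≤ 1`. [cite: MazurTateTeitelbaum1986Invent, §I.4 (4.2) and §I.8] [cite: CremonaAlgorithms1997, §2.8] -/
theorem norm_ratPlusSymbol_zero_le_one_of_even {f : CuspForm (Gamma0 N) 2} (hf : IsNewform0 f)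
    (hreal : ∀ n, (cuspCoeff f n).im = 0) (h2N : ¬ 2 ∣ N) {a₂ : ℤ} (ha₂ : cuspCoeff f 2 = a₂) (ha : Even a₂) :
    ‖((ratPlusSymbol f 0 : ℚ) : ℚ_[2])‖ ≤ 1 := by
  obtain ⟨k, -, hk⟩ := norm_ratPlusSymbol_zero_eq_of_even hf hreal h2N ha₂ ha
  rw [hk]
  exact Padic.norm_int_le_one k

/-- **The layer-`0` coefficient is `2`-integral too**: `‖2·[1/4]⁺_f‖₂ ≤ 1` for `a₂` even (it equals `(a₂² − 2a₂ − 1)[0]⁺`).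
[cite: MazurTateTeitelbaum1986Invent, §I.4 (4.2) and §I.8] -/
theorem norm_two_mul_ratPlusSymbol_quarter_le_one_of_even {f : CuspForm (Gamma0 N) 2} (hf : IsNewform0 f)
    (hreal : ∀ n, (cuspCoeff f n).im = 0) (h2N : ¬ 2 ∣ N) {a₂ : ℤ} (ha₂ : cuspCoeff f 2 = a₂) (ha : Even a₂) :
    ‖(((2 * ratPlusSymbol f (1 / 4) : ℚ)) : ℚ_[2])‖ ≤ 1 := by
  rw [two_mul_ratPlusSymbol_quarter_eq hf h2N ha₂]
  push_cast
  rw [norm_mul]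
  have h1 : ‖((a₂ : ℚ_[2]) ^ 2 - 2 * (a₂ : ℚ_[2]) - 1)‖ ≤ 1 := by
    have : ((a₂ : ℚ_[2]) ^ 2 - 2 * (a₂ : ℚ_[2]) - 1) = ((a₂ ^ 2 - 2 * a₂ - 1 : ℤ) : ℚ_[2]) := by push_cast; ring
    rw [this]; exact Padic.norm_int_le_one _
  calc ‖((a₂ : ℚ_[2]) ^ 2 - 2 * (a₂ : ℚ_[2]) - 1)‖ * ‖((ratPlusSymbol f 0 : ℚ) : ℚ_[2])‖ ≤ 1 * 1 := by
        gcongr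
        exact norm_ratPlusSymbol_zero_le_one_of_even hf hreal h2N ha₂ ha
    _ = 1 := one_mul _

/-- **Every DOUBLED plus symbol `2[x]⁺_f` at a cusp `x` with denominator prime to `N` is `2`-integral** for a newform of odd
level with real coefficients and EVEN `a₂`: Manin (`[x]⁺ = [0]⁺ + k/2`) and `‖[0]⁺‖₂ ≤ 1`. In particular ALL coefficients
`2[a/2^m]⁺_f` of the Mazur–Tate elements of `f` at `2` are `2`-integral — with no Pollack pair in the statement.
[cite: MazurTateTeitelbaum1986Invent, §I.4 (4.2) and §I.8] [cite: CremonaAlgorithms1997, §2.8] -/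
theorem norm_two_mul_ratPlusSymbol_le_one_of_even {f : CuspForm (Gamma0 N) 2} (hf : IsNewform0 f)
    (hreal : ∀ n, (cuspCoeff f n).im = 0) (h2N : ¬ 2 ∣ N) {a₂ : ℤ} (ha₂ : cuspCoeff f 2 = a₂) (ha : Even a₂)
    {x : ℚ} (hx : Nat.Coprime x.den N) :
    ‖(((2 * ratPlusSymbol f x : ℚ)) : ℚ_[2])‖ ≤ 1 := by
  obtain ⟨k, hk⟩ := exists_ratPlusSymbol_eq_add_div_two f hreal hx
  have h0 := norm_ratPlusSymbol_zero_le_one_of_even hf hreal h2N ha₂ ha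
  have hx2 : ((2 * ratPlusSymbol f x : ℚ) : ℚ_[2]) = 2 * ((ratPlusSymbol f 0 : ℚ) : ℚ_[2]) + (k : ℚ_[2]) := by
    rw [hk]; push_cast; ring
  rw [hx2]
  refine (Padic.nonarchimedean _ _).trans (max_le ?_ (Padic.norm_int_le_one k))
  rw [norm_mul]
  have h2 : ‖(2 : ℚ_[2])‖ ≤ 1 := by
    have := Padic.norm_int_le_one (p := 2) 2
    exact_mod_cast this
  calc ‖(2 : ℚ_[2])‖ * ‖((ratPlusSymbol f 0 : ℚ) : ℚ_[2])‖ ≤ 1 * 1 := by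
        gcongr
    _ = 1 := one_mul _

end Norms

end Literature.NumberTheory.EllipticCurves
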